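import Literature.InformationTheory.QuantumCodes.PlanarCodeSpaceTimeLift
import HarnessLib

/-!
# Rough-to-rough self-avoiding SPACE-TIME paths of the planar surface code: their fault locations, their syndrome-freeness,
# their length, and the extraction of one from an odd-crossing space-time cycle (Dennis–Kitaev–Landahl–Preskill §5.3)

Topic `Literature/InformationTheory/QuantumCodes` (venture QEC, LADDER-QEC rung Q5, PARTITION row 09 "phenomenological";
qec-type-09 gen 6, cell item 09.PSAW (C)). All PROVED, kernel axioms, no named fact. Continues `PlanarCodeSpaceTimeLift.lean`
(space-time sites `spv`, bonds `stBond`, incidence = geometry, the hand-shaking lemma `st_exists_reachable_top_of_odd`);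
this is the space-time twin of `PlanarCodeCrossingPaths.lean`:

* `stPathEdge`, `IsSTCrossing`, `pathLocs` — a ROUGH-TO-ROUGH SPACE-TIME PATH, coded by its bottom rough site
  `(-1, b₀, t₀)` and a vertex function `ω : ℕ → ℤ³` from the origin (the tree's `SAW.Zd.saws 3 n`): its `n` bonds are
  bonds of fault locations and it ends on the top rough face `{a = k+1}`; `pathLocs` = those `n` locations
  (`card_pathLocs`), a history WITHOUT space-time syndrome (`stMatrix_mulVec_pathLocs`) and with `n ≥ k + 2`
  (`le_length_of_isSTCrossing`);
* ★ `st_exists_crossing_subset` — a space-time cycle with an odd bottom rough crossing contains a rough-to-rough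
  self-avoiding space-time path whose locations lie in any set supporting the cycle (hand-shaking lemma + Mathlib's
  `Walk.bypass`).

The half-weight step, the counting `≤ (k+2)·T·cₙ(ℤ³)` and the union bound are `PlanarCodeSpaceTimePathsBound.lean`.

## References

* [DennisEtAl2002] E. Dennis, A. Kitaev, A. Landahl, J. Preskill, *Topological quantum memory*, J. Math. Phys. 43 (2002)
  4452–4505, arXiv:quant-ph/0110143, §4.2 (space-time lattice), §5.2 (self-avoiding walks on the space-time lattice,
  `H ≥ L`), §5.3 (relative polygons of planar codes, eq. (saw_3)).
* [MadrasSlade1993] N. Madras, G. Slade, *The Self-Avoiding Walk*, Birkhäuser 1993, §1.1 (`n`-step self-avoiding walks).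
-/

namespace Literature.InformationTheory.QuantumCodes

namespace PlanarCode

open Finset Matrix CSSPhenom
open Literature.Probability.LatticeModels (Site zdGraph)
open Literature.Probability.Percolation (BondConfig openGraph openGraph_adj)
open Literature.Probability.RandomPlanarGeometry.SAW.Zd (saws mem_saws abs_apply_le_of_adj zdGraph_adj_sub_right)

variable {k T : ℕ}

/-- Space-time sites are determined by their coordinates. [folklore] -/
private theorem spv_eq_spv_iff' {a b τ a' b' τ' : ℤ} : spv a b τ = spv a' b' τ' ↔ a = a' ∧ b = b' ∧ τ = τ' := by
  refine ⟨fun h => ?_, by rintro ⟨rfl, rfl, rfl⟩; rfl⟩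
  exact ⟨by simpa [spv] using congrFun h 0, by simpa [spv] using congrFun h 1, by simpa [spv] using congrFun h 2⟩

/-- First coordinate of a space-time site. [folklore] -/
private theorem spv_apply_zero (a b τ : ℤ) : spv a b τ 0 = a := by simp [spv]

/-! ### Rough-to-rough space-time paths -/

/-- The `i`-th bond `{s + ω(i), s + ω(i+1)}` of the space-time path that starts at the bottom rough site
`s = (-1, b₀, t₀)` and follows `ω`. [cite: DennisEtAl2002, §5.3 (relative polygons with endpoints on the boundary)] -/
def stPathEdge (b₀ : Fin (k + 2)) (t₀ : Fin T) (ω : ℕ → Site 3) (i : ℕ) : Sym2 (Site 3) :=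
  s(spv (-1) b₀ t₀ + ω i, spv (-1) b₀ t₀ + ω (i + 1))

/-- **A rough-to-rough space-time path** (`n` steps, bottom site `(-1, b₀, t₀)`, vertex function `ω`): each of its `n`
bonds is the bond of a fault location, and it ends on the top rough face `a = k + 1`.
[cite: DennisEtAl2002, §5.3 (homologically nontrivial relative polygon, endpoints on the boundary)] -/
def IsSTCrossing (k T : ℕ) (b₀ : Fin (k + 2)) (t₀ : Fin T) (n : ℕ) (ω : ℕ → Site 3) : Prop :=
  (∀ i < n, ∃ ℓ : HistoryLoc (PlanarQubit k) (PlanarCheck k) T, stBond ℓ = stPathEdge b₀ t₀ ω i) ∧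
    ∃ (b₁ : Fin (k + 2)) (t₁ : Fin T), spv (-1) b₀ t₀ + ω n = spv ((k : ℤ) + 1) b₁ t₁

open Classical in
/-- The fault locations whose bonds are the first `n` bonds of the space-time path `(b₀, t₀, ω)`.
[cite: DennisEtAl2002, §5.2 (the links of the path)] -/
noncomputable def pathLocs (b₀ : Fin (k + 2)) (t₀ : Fin T) (n : ℕ) (ω : ℕ → Site 3) :
    Finset (HistoryLoc (PlanarQubit k) (PlanarCheck k) T) :=
  univ.filter fun ℓ => ∃ i < n, stBond ℓ = stPathEdge b₀ t₀ ω i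

/-- The bonds of a self-avoiding path are pairwise distinct. [cite: MadrasSlade1993, §1.1] -/
theorem stPathEdge_injOn {n : ℕ} {ω : ℕ → Site 3} (hω : ω ∈ saws 3 n) (b₀ : Fin (k + 2)) (t₀ : Fin T) :
    Set.InjOn (stPathEdge b₀ t₀ ω) (Finset.range n : Set ℕ) := by
  obtain ⟨-, -, -, hinj⟩ := mem_saws.1 hω
  intro i hi j hj h
  simp only [Finset.coe_range, Set.mem_Iio] at hi hj
  simp only [stPathEdge, Sym2.eq_iff, add_right_inj] at h
  rcases h with ⟨h1, -⟩ | ⟨h1, h2⟩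
  · exact hinj (show i ≤ n by omega) (show j ≤ n by omega) h1
  · have hi' := hinj (show i ≤ n by omega) (show j + 1 ≤ n by omega) h1
    have hj' := hinj (show i + 1 ≤ n by omega) (show j ≤ n by omega) h2
    omega

open Classical in
/-- The bond map carries `pathLocs` onto the set of bonds of the path. [cite: DennisEtAl2002, §5.2 (the links of the path)] -/
theorem image_stBond_pathLocs {b₀ : Fin (k + 2)} {t₀ : Fin T} {n : ℕ} {ω : ℕ → Site 3}
    (hX : IsSTCrossing k T b₀ t₀ n ω) :
    (pathLocs b₀ t₀ n ω).image stBond = (Finset.range n).image (stPathEdge b₀ t₀ ω) := by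
  ext e
  simp only [Finset.mem_image, pathLocs, Finset.mem_filter, Finset.mem_univ, true_and, Finset.mem_range]
  constructor
  · rintro ⟨ℓ, ⟨i, hi, hℓ⟩, rfl⟩
    exact ⟨i, hi, hℓ.symm⟩
  · rintro ⟨i, hi, rfl⟩
    obtain ⟨ℓ, hℓ⟩ := hX.1 i hi
    exact ⟨ℓ, ⟨i, hi, hℓ⟩, hℓ⟩

open Classical in
/-- **A crossing self-avoiding space-time path with `n` steps uses exactly `n` fault locations.**
[cite: DennisEtAl2002, §5.2 (H links)] -/
theorem card_pathLocs {b₀ : Fin (k + 2)} {t₀ : Fin T} {n : ℕ} {ω : ℕ → Site 3} (hω : ω ∈ saws 3 n)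
    (hX : IsSTCrossing k T b₀ t₀ n ω) : (pathLocs b₀ t₀ n ω).card = n := by
  rw [← Finset.card_image_of_injective (pathLocs b₀ t₀ n ω) stBond_injective, image_stBond_pathLocs hX,
    Finset.card_image_of_injOn (stPathEdge_injOn hω b₀ t₀), Finset.card_range]

open Classical in
/-- Sums over the locations of the path are sums over its bonds. [cite: DennisEtAl2002, §5.2 (the links of the path)] -/
theorem sum_pathLocs_eq {M : Type*} [AddCommMonoid M] {b₀ : Fin (k + 2)} {t₀ : Fin T} {n : ℕ} {ω : ℕ → Site 3}
    (hω : ω ∈ saws 3 n) (hX : IsSTCrossing k T b₀ t₀ n ω) (g : Sym2 (Site 3) → M) :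
    ∑ ℓ ∈ pathLocs b₀ t₀ n ω, g (stBond ℓ) = ∑ i ∈ Finset.range n, g (stPathEdge b₀ t₀ ω i) := by
  rw [← Finset.sum_image (fun ℓ _ ℓ' _ h => stBond_injective h), image_stBond_pathLocs hX,
    Finset.sum_image (stPathEdge_injOn hω b₀ t₀)]

/-- Telescoping modulo `2`: `Σ_{i<n} (f(i) + f(i+1)) = f(0) + f(n)` in `ℤ₂`. [folklore] -/
private theorem sum_range_add_succ_eq' (f : ℕ → ZMod 2) (n : ℕ) :
    ∑ i ∈ Finset.range n, (f i + f (i + 1)) = f 0 + f n := by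
  have h2 : ∀ x : ZMod 2, x + x = 0 := by decide
  induction n with
  | zero => rw [Finset.sum_range_zero, h2]
  | succ n ih =>
    rw [Finset.sum_range_succ, ih]
    calc f 0 + f n + (f n + f (n + 1)) = f 0 + f (n + 1) + (f n + f n) := by ring
      _ = f 0 + f (n + 1) := by rw [h2, add_zero]

/-- **A rough-to-rough space-time path carries no space-time syndrome**: `stMatrix 𝟙_P = 0` for the location set `P` of
a crossing self-avoiding space-time path — every space-time check is met by `0` or `2` of its bonds (both ends lie on the
virtual faces `a = -1`, `a = k+1`, which carry no check). [cite: DennisEtAl2002, §4.3 (a relative cycle of the space-time lattice ending on the rough faces has no boundary)] -/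
theorem stMatrix_mulVec_pathLocs {b₀ : Fin (k + 2)} {t₀ : Fin T} {n : ℕ} {ω : ℕ → Site 3} (hω : ω ∈ saws 3 n)
    (hX : IsSTCrossing k T b₀ t₀ n ω) {χ : History (PlanarCheck k) (PlanarQubit k) T}
    (hχ : ∀ ℓ, χ ℓ = if ℓ ∈ pathLocs b₀ t₀ n ω then 1 else 0) :
    stMatrix (planarHX k) T *ᵥ χ = 0 := by
  classical
  obtain ⟨h0, -, hadj, -⟩ := mem_saws.1 hω
  obtain ⟨b₁, t₁, hb₁⟩ := hX.2
  funext x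
  rw [Pi.zero_apply, stMatrix_planar_mulVec_apply_eq_sum]
  set v : Site 3 := csite x with hv
  set f : ℕ → ZMod 2 := fun i => if v = spv (-1) b₀ t₀ + ω i then 1 else 0 with hf
  have h1 : (∑ ℓ, if v ∈ stBond ℓ then χ ℓ else 0) =
      ∑ ℓ ∈ pathLocs b₀ t₀ n ω, if v ∈ stBond ℓ then (1 : ZMod 2) else 0 := by
    rw [← Fintype.sum_extend_by_zero (pathLocs b₀ t₀ n ω)]
    refine Finset.sum_congr rfl fun ℓ _ => ?_
    rw [hχ ℓ]
    split_ifs <;> rfl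
  have h2 : ∀ i ∈ Finset.range n, (if v ∈ stPathEdge b₀ t₀ ω i then (1 : ZMod 2) else 0) = f i + f (i + 1) := by
    intro i hi
    rw [Finset.mem_range] at hi
    have hne : spv (-1) b₀ t₀ + ω i ≠ spv (-1) b₀ t₀ + ω (i + 1) := fun h => (hadj i hi).ne (add_left_cancel h)
    simp only [stPathEdge, Sym2.mem_iff, hf]
    by_cases hA : v = spv (-1) b₀ t₀ + ω i
    · have hB : v ≠ spv (-1) b₀ t₀ + ω (i + 1) := fun h => hne (hA.symm.trans h)
      rw [if_pos (Or.inl hA), if_pos hA, if_neg hB, add_zero]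
    · by_cases hB : v = spv (-1) b₀ t₀ + ω (i + 1)
      · rw [if_pos (Or.inr hB), if_neg hA, if_pos hB, zero_add]
      · rw [if_neg (not_or.2 ⟨hA, hB⟩), if_neg hA, if_neg hB, add_zero]
  obtain ⟨⟨a, b⟩, τ⟩ := x
  have h3 : f 0 = 0 := by
    simp only [hf, h0, add_zero, hv]
    rw [if_neg]
    intro h
    have := (spv_eq_spv_iff'.1 h).1
    omega
  have h4 : f n = 0 := by
    simp only [hf, hb₁, hv]
    rw [if_neg]
    intro h
    have := (spv_eq_spv_iff'.1 h).1
    have := a.2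
    omega
  rw [h1, sum_pathLocs_eq hω hX (fun e => if v ∈ e then (1 : ZMod 2) else 0), Finset.sum_congr rfl h2,
    sum_range_add_succ_eq', h3, h4, add_zero]

/-- **A rough-to-rough space-time path has at least `k + 2` bonds**: it climbs from the face `a = -1` to the face
`a = k + 1` one unit at a time. [cite: DennisEtAl2002, §5.2 ("at least L links")] -/
theorem le_length_of_isSTCrossing {b₀ : Fin (k + 2)} {t₀ : Fin T} {n : ℕ} {ω : ℕ → Site 3} (hω : ω ∈ saws 3 n)
    (hX : IsSTCrossing k T b₀ t₀ n ω) : k + 2 ≤ n := by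
  obtain ⟨h0, -, hadj, -⟩ := mem_saws.1 hω
  obtain ⟨b₁, t₁, hb₁⟩ := hX.2
  have hb := abs_apply_le_of_adj h0 hadj n le_rfl 0
  have hc := congrFun hb₁ 0
  rw [Pi.add_apply, spv_apply_zero, spv_apply_zero] at hc
  have hωn : ω n 0 = (k : ℤ) + 2 := by linarith
  rw [hωn] at hb
  have := le_of_abs_le hb
  omega

/-! ### Extraction -/

/-- ★ **A space-time cycle with an odd bottom rough crossing contains a rough-to-rough self-avoiding space-time path**
whose fault locations lie in any set `Er` supporting the cycle: the hand-shaking lemma (`st_exists_reachable_top_of_odd`)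
joins a bottom rough site to a top rough site through bonds of `Er`; removing loops (Mathlib's `Walk.bypass`) leaves a
self-avoiding walk, which read from its start is an `n`-step self-avoiding walk of `ℤ³` (the tree's `SAW.Zd.saws 3 n`).
[cite: DennisEtAl2002, §5.2–5.3 (self-avoiding walks of the space-time lattice; relative polygons)] -/
theorem st_exists_crossing_subset {Er : Finset (HistoryLoc (PlanarQubit k) (PlanarCheck k) T)}
    {C : History (PlanarCheck k) (PlanarQubit k) T} (hC : stMatrix (planarHX k) T *ᵥ C = 0)
    (hCE : ∀ ℓ, C ℓ ≠ 0 → ℓ ∈ Er) (hodd : ∑ b : Fin (k + 2), proj C (Sum.inl (0, b)) = 1) :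
    ∃ (b₀ : Fin (k + 2)) (t₀ : Fin T) (n : ℕ) (ω : ℕ → Site 3),
      ω ∈ saws 3 n ∧ IsSTCrossing k T b₀ t₀ n ω ∧ pathLocs b₀ t₀ n ω ⊆ Er := by
  classical
  obtain ⟨b₀, t₀, b₁, t₁, hreach⟩ := st_exists_reachable_top_of_odd hC hCE hodd
  obtain ⟨W⟩ := hreach
  set s : Site 3 := spv (-1) b₀ t₀ with hs
  set t : Site 3 := spv ((k : ℤ) + 1) b₁ t₁ with ht
  set P : (openGraph (stLift Er)).Walk s t := W.bypass with hP
  have hpath : P.IsPath := W.bypass_isPath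
  set n := P.length with hn
  set ω : ℕ → Site 3 := fun i => P.getVert i - s with hω
  have hωs : ∀ i, s + ω i = P.getVert i := fun i => by
    simp only [hω]; abel
  -- each step of the walk is an open bond of the lift, i.e. the bond of a location of `Er`
  have hstep : ∀ i < n, ∃ ℓ ∈ Er, stBond ℓ = stPathEdge b₀ t₀ ω i := by
    intro i hi
    have hA := P.adj_getVert_succ hi
    rw [openGraph_adj] at hA
    obtain ⟨⟨ℓ, hℓ, hℓe⟩, -⟩ := hA
    refine ⟨ℓ, hℓ, ?_⟩
    rw [hℓe, stPathEdge, ← hs, hωs, hωs]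
  refine ⟨b₀, t₀, n, ω, ?_, ⟨fun i hi => ?_, b₁, t₁, ?_⟩, fun ℓ hℓ => ?_⟩
  · refine mem_saws.2 ⟨by simp [hω], fun i hi => ?_, fun i hi => ?_, fun i hi j hj hij => ?_⟩
    · simp only [hω]
      rw [P.getVert_of_length_le hi, P.getVert_length]
    · obtain ⟨ℓ, -, hℓ⟩ := hstep i hi
      have hA := zdGraph_adj_of_stBond_eq ℓ hℓ
      rwa [← zdGraph_adj_sub_right _ _ s, add_sub_cancel_left, add_sub_cancel_left] at hA
    · exact hpath.getVert_injOn hi hj (sub_left_injective hij)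
  · obtain ⟨ℓ, -, hℓ⟩ := hstep i hi
    exact ⟨ℓ, hℓ⟩
  · rw [hωs, P.getVert_of_length_le le_rfl]
  · rw [pathLocs, Finset.mem_filter] at hℓ
    obtain ⟨i, hi, hℓi⟩ := hℓ.2
    obtain ⟨ℓ', hℓ', hℓ'i⟩ := hstep i hi
    rwa [← stBond_injective (hℓi.trans hℓ'i.symm)] at hℓ'

end PlanarCode

end Literature.InformationTheory.QuantumCodes
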